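import Summits.ValiantsHypothesis.ValiantsHypothesis.Theorems.LacunarySymmetroidMatrixDescartesCensusDoorA34IsotropicTangent

/-!
# `MatrixDescartes` census — DOOR A at `(3,4)`: the TANGENT-PENCIL CENTRE LAW — the second (and, located, last) sign-level obstruction for
# isotropic pencils with a monomial border: unanimity of the three terms of the centre coefficient

HONEST FRAMING.  Object-search cell `pub-symmetroid`, door-A seat `val-sym-door-p3` (g14); helper file beside the OPEN typed statement
`DoorA34 = PosRootLawAt 3 4 18` (route item `Theses.LacunarySymmetroid.DoorA34`, stmt-ValiantsHypothesis-19980), asserted nowhere.  Companion of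
`…CensusDoorA34IsotropicTangent` (the PARITY law).  Same family: isotropic letters `!![a_l,c_l,u_l; c_l,b_l,v_l; u_l,v_l,0]` with `u_l = 0` for
`l ≠ m` (border direction containing the monomial `X^(d m)`; three conics mutually tangent at the common point; all letters indefinite; full support).

THE LAW.  For a nineteen the face block is `−A'·V'²` (`…IsotropicTangent`), so besides the cubes `−a_iv_i²` and the edge coefficients the CENTRE
coefficient at `d_i + d_j + d_k` is `−2(a_iv_jv_k + a_jv_iv_k + a_kv_iv_j)` (`trace_adjugate_mixed_isoLetter_tangent`, uncollided for a nineteen by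
`mixed_unique_of_nineteen`).  The parity law's edge analysis FIXES the signs `sign(v_av_b)` (negative iff the edge `{a,b}` alternates at least
twice) and full alternation fixes the signs of the cubes relative to each other; hence the three terms of the centre coefficient have KNOWN
relative signs.  If they are UNANIMOUS and opposite to the sign full alternation demands at `d_i+d_j+d_k`, no nineteen exists:
**`card_posRoots_isoTangent_le_18_centre`** — `Z₊ ≤ 18` under a second decidable test of `d` (all hypotheses over `ℤ`, by `decide` on
instances: `…_on_0_1_8_11` (`m = 0`) and `…_on_0_1_10_14` (`m = 0`; the support of the two R0 census sixteens), neither of which the parity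
law reaches).

SCOPE (located bookkeeping, seat scripts `ratiolaw.py` / `signlaw_tangent.py`): parity ∨ centre obstructs `4528` of the `8240` pairs `(d,m)` with
`d₃ ≤ 30` (parity alone `4016`); a 2-D grid decision of the complete face sign system finds nothing beyond «parity ∨ centre» except boundary
slivers (400 vs 366 of 664 at `d₃ ≤ 17`), i.e. these two laws are, located, the whole sign-level content of the tangent family; the remaining
supports need magnitudes (the located FACE NEWTON-CONE LAW of the seat report).  Nothing here bounds `ζ_sym(3,4)` (`∈ {18,19}` unchanged) or
`DoorA34`; nothing bears on `MatrixDescartes` (stmt-ValiantsHypothesis-18050) or on `VP ≠ VNP` — VP≠VNP not moved.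

[folklore] Descartes' rule of signs (full alternation, `…FullAlternation`); elementary sign bookkeeping.
-/

-- `Summit.ValiantsHypothesis.ValiantsHypothesis.…` repeats a component by the D-0017 layout
-- (single-conjunct summit), which the `dupNamespace` linter flags; the name is mandated.
set_option linter.dupNamespace false

namespace Summit.ValiantsHypothesis.ValiantsHypothesis.Theorems.LacunarySymmetroidMatrixDescartes.Census

open Polynomial Finset
open scoped BigOperators Polynomial Matrix

/-! ## 1. The centre coefficient of a tangent pencil -/

/-- Finite bookkeeping: a map `f : Fin 3 → Fin 4` with value multiset `{i, j, k}` (pairwise distinct) is one of the six arrangements. [folklore] -/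
theorem fin3_of_univ_val_map_eq_three (i j k : Fin 4) (hij : i ≠ j) (hik : i ≠ k) (hjk : j ≠ k) (f : Fin 3 → Fin 4)
    (h : Finset.univ.val.map f = Finset.univ.val.map (![i, j, k] : Fin 3 → Fin 4)) :
    f = ![i, j, k] ∨ f = ![i, k, j] ∨ f = ![j, i, k] ∨ f = ![j, k, i] ∨ f = ![k, i, j] ∨ f = ![k, j, i] := by
  revert i j k hij hik hjk f; decide

/-- `19` positive roots ⇒ the mixed exponent `d i + d j + d k` (`i, j, k` pairwise distinct) is represented only by the arrangements of `{i,j,k}`.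
[folklore] -/
theorem mixed_unique_of_nineteen (d : Fin 4 → ℕ) (S : Fin 4 → Matrix (Fin 3) (Fin 3) ℝ)
    (h19 : 19 ≤ ((Matrix.det (∑ l, ((X : ℝ[X]) ^ d l) • (S l).map C)).roots.toFinset.filter (fun t => 0 < t)).card)
    {i j k : Fin 4} (hij : i ≠ j) (hik : i ≠ k) (hjk : j ≠ k) :
    ∀ f : Fin 3 → Fin 4, (∑ t, d (f t)) = d i + d j + d k →
      f = ![i, j, k] ∨ f = ![i, k, j] ∨ f = ![j, i, k] ∨ f = ![j, k, i] ∨ f = ![k, i, j] ∨ f = ![k, j, i] := by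
  intro f hf
  have hinj := sym_sum_injective_of_nineteen d S h19
  have hg : (∑ t, d ((![i, j, k] : Fin 3 → Fin 4) t)) = d i + d j + d k := by
    simp [Fin.sum_univ_three, add_assoc]
  have hsum : (((⟨Finset.univ.val.map f, StubDescartesCeiling.card_map_univ_val f⟩ : Sym (Fin 4) 3) : Multiset (Fin 4)).map d).sum
      = (((⟨Finset.univ.val.map (![i, j, k] : Fin 3 → Fin 4), StubDescartesCeiling.card_map_univ_val _⟩ : Sym (Fin 4) 3) :
          Multiset (Fin 4)).map d).sum := by
    change ((Finset.univ.val.map f).map d).sum = ((Finset.univ.val.map (![i, j, k] : Fin 3 → Fin 4)).map d).sum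
    rw [← StubDescartesCeiling.sum_eq_sym_sum, ← StubDescartesCeiling.sum_eq_sym_sum, hf, hg]
  exact fin3_of_univ_val_map_eq_three i j k hij hik hjk f (congrArg (fun s : Sym (Fin 4) 3 => (s : Multiset (Fin 4))) (hinj hsum))

/-- **Centre coefficient of three tangent letters**: `tr((adj(S_i+S_j) − adj S_i − adj S_j)·S_k) = −2(a_iv_jv_k + a_jv_iv_k + a_kv_iv_j)`
when `u_i = u_j = u_k = 0`. [folklore] -/
theorem trace_adjugate_mixed_isoLetter_tangent {K : ℕ} (E : Fin 5 → Fin K → ℝ) {i j k : Fin K}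
    (hi : E 3 i = 0) (hj : E 3 j = 0) (hk : E 3 k = 0) :
    ((((!![E 0 i, E 2 i, E 3 i; E 2 i, E 1 i, E 4 i; E 3 i, E 4 i, 0] : Matrix (Fin 3) (Fin 3) ℝ)
        + !![E 0 j, E 2 j, E 3 j; E 2 j, E 1 j, E 4 j; E 3 j, E 4 j, 0]).adjugate
        - (!![E 0 i, E 2 i, E 3 i; E 2 i, E 1 i, E 4 i; E 3 i, E 4 i, 0] : Matrix (Fin 3) (Fin 3) ℝ).adjugate
        - (!![E 0 j, E 2 j, E 3 j; E 2 j, E 1 j, E 4 j; E 3 j, E 4 j, 0] : Matrix (Fin 3) (Fin 3) ℝ).adjugate)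
        * (!![E 0 k, E 2 k, E 3 k; E 2 k, E 1 k, E 4 k; E 3 k, E 4 k, 0] : Matrix (Fin 3) (Fin 3) ℝ)).trace
      = -(2 * (E 0 i * E 4 j * E 4 k + E 0 j * E 4 i * E 4 k + E 0 k * E 4 i * E 4 j)) := by
  have hadd : ((!![E 0 i, E 2 i, E 3 i; E 2 i, E 1 i, E 4 i; E 3 i, E 4 i, 0] : Matrix (Fin 3) (Fin 3) ℝ)
        + !![E 0 j, E 2 j, E 3 j; E 2 j, E 1 j, E 4 j; E 3 j, E 4 j, 0])
      = !![E 0 i + E 0 j, E 2 i + E 2 j, E 3 i + E 3 j; E 2 i + E 2 j, E 1 i + E 1 j, E 4 i + E 4 j;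
          E 3 i + E 3 j, E 4 i + E 4 j, 0 + 0] := by
    ext a b; fin_cases a <;> fin_cases b <;> rfl
  rw [hadd]
  simp only [Matrix.trace_fin_three, Matrix.mul_apply, Fin.sum_univ_three, Matrix.adjugate_fin_three, Matrix.of_apply,
    Matrix.sub_apply, Matrix.cons_val', Matrix.cons_val_zero, Matrix.cons_val_one, Matrix.cons_val_two, Matrix.empty_val',
    Matrix.cons_val_fin_one, Matrix.head_cons, Matrix.tail_cons, Matrix.head_fin_const, hi, hj, hk]
  ring

/-! ## 2. The centre law -/

/-- **TANGENT-PENCIL CENTRE LAW (all supports).**  Isotropic letters with `u_l = 0` for `l ≠ m`; `ρ` the rank function of the triple-sum table; for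
an edge `{a,b}` let `N_ab` := «at least two of `ρ(3d_a)+ρ(2d_a+d_b)`, `ρ(2d_a+d_b)+ρ(2d_b+d_a)`, `ρ(2d_b+d_a)+ρ(3d_b)` are odd» and
`s_ab = −1` if `N_ab` else `1` (the forced sign of `v_av_b`), `q_a = (−1)^(ρ(3d_i)+ρ(3d_a))` (sign of the cube at `a` relative to the cube at `i`),
`w = (−1)^(ρ(3d_i)+ρ(d_i+d_j+d_k))` (sign full alternation demands at the centre, relative to the cube at `i`).  If the three centre terms are
unanimous against it — `s_jk = q_j s_ik`, `s_jk = q_k s_ij` and `s_jk = −w` (integers, decidable) — the determinant has at most `18` distinct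
positive roots. [folklore] -/
theorem card_posRoots_isoTangent_le_18_centre (d : Fin 4 → ℕ) (E : Fin 5 → Fin 4 → ℝ) (m i j k : Fin 4)
    (him : i ≠ m) (hjm : j ≠ m) (hkm : k ≠ m) (hij : i ≠ j) (hik : i ≠ k) (hjk : j ≠ k)
    (hU : ∀ l, l ≠ m → E 3 l = 0)
    (ρ : ℕ → ℕ) (hρ : ∀ e, ρ e = (((Finset.univ : Finset (Fin 4 × Fin 4 × Fin 4)).image
      (fun p => d p.1 + d p.2.1 + d p.2.2)).filter (· < e)).card)
    (hcentre :
      let sij : ℤ := if 2 ≤ (ρ (3 * d i) + ρ (2 * d i + d j)) % 2 + (ρ (2 * d i + d j) + ρ (2 * d j + d i)) % 2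
              + (ρ (2 * d j + d i) + ρ (3 * d j)) % 2 then -1 else 1
      let sik : ℤ := if 2 ≤ (ρ (3 * d i) + ρ (2 * d i + d k)) % 2 + (ρ (2 * d i + d k) + ρ (2 * d k + d i)) % 2
              + (ρ (2 * d k + d i) + ρ (3 * d k)) % 2 then -1 else 1
      let sjk : ℤ := if 2 ≤ (ρ (3 * d j) + ρ (2 * d j + d k)) % 2 + (ρ (2 * d j + d k) + ρ (2 * d k + d j)) % 2
              + (ρ (2 * d k + d j) + ρ (3 * d k)) % 2 then -1 else 1
      sjk = (-1) ^ (ρ (3 * d i) + ρ (3 * d j)) * sik ∧ sjk = (-1) ^ (ρ (3 * d i) + ρ (3 * d k)) * sij ∧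
      sjk = -(-1) ^ (ρ (3 * d i) + ρ (d i + d j + d k))) :
    ((((∑ l, (X : ℝ[X]) ^ d l • (!![E 0 l, E 2 l, E 3 l; E 2 l, E 1 l, E 4 l; E 3 l, E 4 l, 0] :
      Matrix (Fin 3) (Fin 3) ℝ).map C).det).roots.toFinset.filter (fun t => 0 < t)).card) ≤ 18 := by
  classical
  by_contra hlt; push Not at hlt
  set S : Fin 4 → Matrix (Fin 3) (Fin 3) ℝ :=
    fun l => !![E 0 l, E 2 l, E 3 l; E 2 l, E 1 l, E 4 l; E 3 l, E 4 l, 0] with hSdef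
  set P : ℝ[X] := (∑ l, (X : ℝ[X]) ^ d l • (S l).map C).det with hPdef
  have h19 : 19 ≤ (P.roots.toFinset.filter (fun t => 0 < t)).card := by omega
  -- edge signs (from the parity file)
  obtain ⟨nij, pij⟩ := tangent_edge_sign d E hij (hU i him) (hU j hjm) h19 ρ hρ
  obtain ⟨⟨nik, pik⟩, ⟨njk, pjk⟩⟩ := And.intro (tangent_edge_sign d E hik (hU i him) (hU k hkm) h19 ρ hρ)
    (tangent_edge_sign d E hjk (hU j hjm) (hU k hkm) h19 ρ hρ)
  -- support bookkeeping (as in `tangent_edge_sign`)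
  have hP0 : P ≠ 0 := fun h0 => by
    rw [h0, Polynomial.roots_zero, Multiset.toFinset_zero, Finset.filter_empty, Finset.card_empty] at h19; omega
  set T : Finset ℕ := (Finset.univ : Finset (Fin 4 × Fin 4 × Fin 4)).image (fun p => d p.1 + d p.2.1 + d p.2.2) with hTdef
  have hT20 : T.card ≤ 20 := card_tripleSums_le_of_collapse d id (fun _ => rfl) (by decide)
  have hsum3 : (Finset.univ : Finset (Fin 3 → Fin 4)).image (fun g => ∑ t, d (g t)) = T := sumset_three_eq_tripleSums d
  have hZ : ((Finset.univ : Finset (Fin 3 → Fin 4)).image (fun g => ∑ t, d (g t))).card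
      ≤ (P.roots.toFinset.filter (fun t => 0 < t)).card + 1 := by rw [hsum3]; omega
  have hsupp : P.support = T := by rw [← hsum3]; exact support_det_pencil_eq_sumset_of_sharp d S hP0 hZ
  have hZ' : P.support.card ≤ (P.roots.toFinset.filter (fun t => 0 < t)).card + 1 := by rw [hsupp]; omega
  have memT : ∀ a b c : Fin 4, d a + d b + d c ∈ P.support := fun a b c => by
    rw [hsupp, hTdef]; exact Finset.mem_image.mpr ⟨(a, b, c), Finset.mem_univ _, rfl⟩
  have hrank : ∀ e, (P.support.filter (· < e)).card = ρ e := fun e => by rw [hρ, hsupp]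
  -- cube and centre coefficients
  have hci : P.coeff (3 * d i) = -(E 0 i * E 4 i ^ 2) := by
    rw [hPdef, coeff_det_pencil_three_mul d S i (cube_unique_of_nineteen d S h19 i), hSdef]; exact det_isoLetter_tangent E (hU i him)
  have hcj : P.coeff (3 * d j) = -(E 0 j * E 4 j ^ 2) := by
    rw [hPdef, coeff_det_pencil_three_mul d S j (cube_unique_of_nineteen d S h19 j), hSdef]; exact det_isoLetter_tangent E (hU j hjm)
  have hck : P.coeff (3 * d k) = -(E 0 k * E 4 k ^ 2) := by
    rw [hPdef, coeff_det_pencil_three_mul d S k (cube_unique_of_nineteen d S h19 k), hSdef]; exact det_isoLetter_tangent E (hU k hkm)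
  have hcc : P.coeff (d i + d j + d k) = -(2 * (E 0 i * E 4 j * E 4 k + E 0 j * E 4 i * E 4 k + E 0 k * E 4 i * E 4 j)) := by
    rw [hPdef, coeff_det_pencil_three_mixed d S hij hik hjk (mixed_unique_of_nineteen d S h19 hij hik hjk), hSdef]
    exact trace_adjugate_mixed_isoLetter_tangent E (hU i him) (hU j hjm) (hU k hkm)
  have mi : 3 * d i ∈ P.support := by rw [show 3 * d i = d i + d i + d i by ring]; exact memT i i i
  have mj : 3 * d j ∈ P.support := by rw [show 3 * d j = d j + d j + d j by ring]; exact memT j j j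
  have mk : 3 * d k ∈ P.support := by rw [show 3 * d k = d k + d k + d k by ring]; exact memT k k k
  have mc : d i + d j + d k ∈ P.support := memT i j k
  have rj := pow_rank_mul_coeff_mul_coeff_pos_of_sharp P hZ' mi mj
  have rk := pow_rank_mul_coeff_mul_coeff_pos_of_sharp P hZ' mi mk
  have rc := pow_rank_mul_coeff_mul_coeff_pos_of_sharp P hZ' mi mc
  rw [hrank, hrank] at rj rk rc
  rw [hci, hcj] at rj; rw [hci, hck] at rk; rw [hci, hcc] at rc
  -- the entries involved are non-zero (cube coefficients of a nineteen)
  have hdi := det_letter_ne_zero_of_nineteen d S h19 i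
  have hdj := det_letter_ne_zero_of_nineteen d S h19 j
  have hdk := det_letter_ne_zero_of_nineteen d S h19 k
  rw [show (S i).det = -(E 0 i * E 4 i ^ 2) from det_isoLetter_tangent E (hU i him)] at hdi
  rw [show (S j).det = -(E 0 j * E 4 j ^ 2) from det_isoLetter_tangent E (hU j hjm)] at hdj
  rw [show (S k).det = -(E 0 k * E 4 k ^ 2) from det_isoLetter_tangent E (hU k hkm)] at hdk
  have hai : E 0 i ≠ 0 := fun h => hdi (by rw [h]; ring)
  have haj : E 0 j ≠ 0 := fun h => hdj (by rw [h]; ring)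
  have hak : E 0 k ≠ 0 := fun h => hdk (by rw [h]; ring)
  have hvi : E 4 i ≠ 0 := fun h => hdi (by rw [h]; ring)
  have hvj : E 4 j ≠ 0 := fun h => hdj (by rw [h]; ring)
  have hvk : E 4 k ≠ 0 := fun h => hdk (by rw [h]; ring)
  have hvi2 : 0 < E 4 i ^ 2 := by positivity
  have hvj2 : 0 < E 4 j ^ 2 := by positivity
  have hvk2 : 0 < E 4 k ^ 2 := by positivity
  -- unpack the decidable hypothesis into real sign relations
  dsimp only at hcentre
  obtain ⟨h1, h2, h3⟩ := hcentre
  -- abbreviations for the three edge counts (natural numbers)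
  set cij : ℕ := (ρ (3 * d i) + ρ (2 * d i + d j)) % 2 + (ρ (2 * d i + d j) + ρ (2 * d j + d i)) % 2
              + (ρ (2 * d j + d i) + ρ (3 * d j)) % 2 with hcij
  set cik : ℕ := (ρ (3 * d i) + ρ (2 * d i + d k)) % 2 + (ρ (2 * d i + d k) + ρ (2 * d k + d i)) % 2
              + (ρ (2 * d k + d i) + ρ (3 * d k)) % 2 with hcik
  set cjk : ℕ := (ρ (3 * d j) + ρ (2 * d j + d k)) % 2 + (ρ (2 * d j + d k) + ρ (2 * d k + d j)) % 2
              + (ρ (2 * d k + d j) + ρ (3 * d k)) % 2 with hcjk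
  -- real versions of the forced signs: v_a v_b has the sign of s_ab
  have sgn_ij : 0 < (((if 2 ≤ cij then (-1 : ℤ) else 1) : ℤ) : ℝ) * (E 4 i * E 4 j) := by
    by_cases hp : 2 ≤ cij
    · rw [if_pos hp]; push_cast; linarith only [nij hp]
    · rw [if_neg hp]; push_cast; linarith only [pij (by omega)]
  have sgn_ik : 0 < (((if 2 ≤ cik then (-1 : ℤ) else 1) : ℤ) : ℝ) * (E 4 i * E 4 k) := by
    by_cases hp : 2 ≤ cik
    · rw [if_pos hp]; push_cast; linarith only [nik hp]
    · rw [if_neg hp]; push_cast; linarith only [pik (by omega)]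
  have sgn_jk : 0 < (((if 2 ≤ cjk then (-1 : ℤ) else 1) : ℤ) : ℝ) * (E 4 j * E 4 k) := by
    by_cases hp : 2 ≤ cjk
    · rw [if_pos hp]; push_cast; linarith only [njk hp]
    · rw [if_neg hp]; push_cast; linarith only [pjk (by omega)]
  -- cast the integer hypotheses to ℝ
  have h1r : (((if 2 ≤ cjk then (-1 : ℤ) else 1) : ℤ) : ℝ) = (-1 : ℝ) ^ (ρ (3 * d i) + ρ (3 * d j)) * (((if 2 ≤ cik then (-1 : ℤ) else 1) : ℤ) : ℝ) := by
    exact_mod_cast h1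
  have h2r : (((if 2 ≤ cjk then (-1 : ℤ) else 1) : ℤ) : ℝ) = (-1 : ℝ) ^ (ρ (3 * d i) + ρ (3 * d k)) * (((if 2 ≤ cij then (-1 : ℤ) else 1) : ℤ) : ℝ) := by
    exact_mod_cast h2
  have h3r : (((if 2 ≤ cjk then (-1 : ℤ) else 1) : ℤ) : ℝ) = -(-1 : ℝ) ^ (ρ (3 * d i) + ρ (d i + d j + d k)) := by
    exact_mod_cast h3
  -- the unit σ := s_jk ∈ {±1}
  set σ : ℝ := (((if 2 ≤ cjk then (-1 : ℤ) else 1) : ℤ) : ℝ) with hσ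
  have hσ1 : σ = (-1 : ℝ) ^ (ρ (3 * d i) + ρ (3 * d j)) * (((if 2 ≤ cik then (-1 : ℤ) else 1) : ℤ) : ℝ) := h1r
  have hσ2 : σ = (-1 : ℝ) ^ (ρ (3 * d i) + ρ (3 * d k)) * (((if 2 ≤ cij then (-1 : ℤ) else 1) : ℤ) : ℝ) := h2r
  have hσ3 : (-1 : ℝ) ^ (ρ (3 * d i) + ρ (d i + d j + d k)) = -σ := by linarith only [h3r]
  -- TERM 1: a_i v_j v_k has the sign of  a_i · σ ; relative to a_i:  σ · a_i · (a_i v_j v_k) = σ a_i² v_jv_k > 0... we show each term T has σ·sign(a_i)... use products with a_i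
  -- Key: all three products  a_i * T_n * σ' are positive where σ' is a common unit; then (a_i σ') * centre-sum > 0, contradicting rc & h3.
  -- term1: E0i*E4j*E4k :  (E0i) * term1 = E0i^2 * (E4j E4k), sign σ  ⇒ 0 < σ * E0i * term1
  have t1 : 0 < σ * (E 0 i * (E 0 i * E 4 j * E 4 k)) := by
    have e : σ * (E 0 i * (E 0 i * E 4 j * E 4 k)) = (σ * (E 4 j * E 4 k)) * E 0 i ^ 2 := by ring
    rw [e]; exact mul_pos sgn_jk (by positivity)
  -- term2: E0j*E4i*E4k : E0i * term2 = (E0i E0j)(E4i E4k); sign(E0iE0j) = (-1)^(ρ3i+ρ3j) (from rj and squares), sign(E4iE4k) = s_ik; product = s_jk = σ by h1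
  have t2 : 0 < σ * (E 0 i * (E 0 j * E 4 i * E 4 k)) := by
    -- from rj: 0 < u1 * ((-(E0i E4i²)) * (-(E0j E4j²))) = u1 * E0iE0j * E4i² E4j²
    have hq : 0 < (-1 : ℝ) ^ (ρ (3 * d i) + ρ (3 * d j)) * (E 0 i * E 0 j) := by
      have e : (-1 : ℝ) ^ (ρ (3 * d i) + ρ (3 * d j)) * (-(E 0 i * E 4 i ^ 2) * -(E 0 j * E 4 j ^ 2))
          = ((-1 : ℝ) ^ (ρ (3 * d i) + ρ (3 * d j)) * (E 0 i * E 0 j)) * (E 4 i ^ 2 * E 4 j ^ 2) := by ring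
      rw [e] at rj; exact (pos_iff_pos_of_mul_pos rj).mpr (by positivity)
    have e : σ * (E 0 i * (E 0 j * E 4 i * E 4 k))
        = (((-1 : ℝ) ^ (ρ (3 * d i) + ρ (3 * d j)) * (E 0 i * E 0 j)) *
          ((((if 2 ≤ cik then (-1 : ℤ) else 1) : ℤ) : ℝ) * (E 4 i * E 4 k))) := by
      rw [hσ1]; ring
    rw [e]; exact mul_pos hq sgn_ik
  have t3 : 0 < σ * (E 0 i * (E 0 k * E 4 i * E 4 j)) := by
    have hq : 0 < (-1 : ℝ) ^ (ρ (3 * d i) + ρ (3 * d k)) * (E 0 i * E 0 k) := by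
      have e : (-1 : ℝ) ^ (ρ (3 * d i) + ρ (3 * d k)) * (-(E 0 i * E 4 i ^ 2) * -(E 0 k * E 4 k ^ 2))
          = ((-1 : ℝ) ^ (ρ (3 * d i) + ρ (3 * d k)) * (E 0 i * E 0 k)) * (E 4 i ^ 2 * E 4 k ^ 2) := by ring
      rw [e] at rk; exact (pos_iff_pos_of_mul_pos rk).mpr (by positivity)
    have e : σ * (E 0 i * (E 0 k * E 4 i * E 4 j))
        = (((-1 : ℝ) ^ (ρ (3 * d i) + ρ (3 * d k)) * (E 0 i * E 0 k)) *
          ((((if 2 ≤ cij then (-1 : ℤ) else 1) : ℤ) : ℝ) * (E 4 i * E 4 j))) := by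
      rw [hσ2]; ring
    rw [e]; exact mul_pos hq sgn_ij
  -- hence σ * E0i * (sum of terms) > 0, i.e. σ * E0i * centre < 0 (centre = -2·sum)
  have hsum : 0 < σ * (E 0 i * (E 0 i * E 4 j * E 4 k + E 0 j * E 4 i * E 4 k + E 0 k * E 4 i * E 4 j)) := by
    have e : σ * (E 0 i * (E 0 i * E 4 j * E 4 k + E 0 j * E 4 i * E 4 k + E 0 k * E 4 i * E 4 j))
        = σ * (E 0 i * (E 0 i * E 4 j * E 4 k)) + σ * (E 0 i * (E 0 j * E 4 i * E 4 k)) + σ * (E 0 i * (E 0 k * E 4 i * E 4 j)) := by ring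
    rw [e]; exact add_pos (add_pos t1 t2) t3
  -- full alternation: 0 < u3 * (c_iii * c_centre) = u3 * (E0i E4i²) * 2 * sum ; with h3r: u3 = -σ ⇒ contradiction
  have e : (-1 : ℝ) ^ (ρ (3 * d i) + ρ (d i + d j + d k)) *
        (-(E 0 i * E 4 i ^ 2) * -(2 * (E 0 i * E 4 j * E 4 k + E 0 j * E 4 i * E 4 k + E 0 k * E 4 i * E 4 j)))
      = -(σ * (E 0 i * (E 0 i * E 4 j * E 4 k + E 0 j * E 4 i * E 4 k + E 0 k * E 4 i * E 4 j))) * (2 * E 4 i ^ 2) := by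
    rw [hσ3]; ring
  rw [e] at rc
  have hneg : -(σ * (E 0 i * (E 0 i * E 4 j * E 4 k + E 0 j * E 4 i * E 4 k + E 0 k * E 4 i * E 4 j))) * (2 * E 4 i ^ 2) < 0 :=
    mul_neg_of_neg_of_pos (neg_neg_of_pos hsum) (by positivity)
  exact absurd rc (not_lt.mpr hneg.le)

/-! ## 3. Instances (the centre test by `decide`; neither support is reached by the parity law) -/

/-- **`(0,1,8,11)`, border along `X^0`**: at most `18` distinct positive roots for every tangent isotropic pencil. [folklore] -/
theorem card_posRoots_isoTangent_le_18_centre_on_0_1_8_11 (E : Fin 5 → Fin 4 → ℝ) (hU : ∀ l, l ≠ 0 → E 3 l = 0) :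
    ((((∑ l, (X : ℝ[X]) ^ (![0, 1, 8, 11] : Fin 4 → ℕ) l • (!![E 0 l, E 2 l, E 3 l; E 2 l, E 1 l, E 4 l; E 3 l, E 4 l, 0] :
      Matrix (Fin 3) (Fin 3) ℝ).map C).det).roots.toFinset.filter (fun t => 0 < t)).card) ≤ 18 := by
  have hT : ((Finset.univ : Finset (Fin 4 × Fin 4 × Fin 4)).image
      (fun p => (![0, 1, 8, 11] : Fin 4 → ℕ) p.1 + (![0, 1, 8, 11] : Fin 4 → ℕ) p.2.1 + (![0, 1, 8, 11] : Fin 4 → ℕ) p.2.2))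
        = ({0, 1, 2, 3, 8, 9, 10, 11, 12, 13, 16, 17, 19, 20, 22, 23, 24, 27, 30, 33} : Finset ℕ) := by decide
  refine card_posRoots_isoTangent_le_18_centre _ E 0 1 2 3 (by decide) (by decide) (by decide) (by decide) (by decide) (by decide) hU
    (fun e => ((({0, 1, 2, 3, 8, 9, 10, 11, 12, 13, 16, 17, 19, 20, 22, 23, 24, 27, 30, 33} : Finset ℕ)).filter (· < e)).card) (fun e => by rw [hT]) ?_
  decide

/-- **`(0,1,10,14)`, border along `X^0`** (the support of the two class-R0 census sixteens): at most `18`. [folklore] -/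
theorem card_posRoots_isoTangent_le_18_centre_on_0_1_10_14 (E : Fin 5 → Fin 4 → ℝ) (hU : ∀ l, l ≠ 0 → E 3 l = 0) :
    ((((∑ l, (X : ℝ[X]) ^ (![0, 1, 10, 14] : Fin 4 → ℕ) l • (!![E 0 l, E 2 l, E 3 l; E 2 l, E 1 l, E 4 l; E 3 l, E 4 l, 0] :
      Matrix (Fin 3) (Fin 3) ℝ).map C).det).roots.toFinset.filter (fun t => 0 < t)).card) ≤ 18 := by
  have hT : ((Finset.univ : Finset (Fin 4 × Fin 4 × Fin 4)).image
      (fun p => (![0, 1, 10, 14] : Fin 4 → ℕ) p.1 + (![0, 1, 10, 14] : Fin 4 → ℕ) p.2.1 + (![0, 1, 10, 14] : Fin 4 → ℕ) p.2.2))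
        = ({0, 1, 2, 3, 10, 11, 12, 14, 15, 16, 20, 21, 24, 25, 28, 29, 30, 34, 38, 42} : Finset ℕ) := by decide
  refine card_posRoots_isoTangent_le_18_centre _ E 0 1 2 3 (by decide) (by decide) (by decide) (by decide) (by decide) (by decide) hU
    (fun e => ((({0, 1, 2, 3, 10, 11, 12, 14, 15, 16, 20, 21, 24, 25, 28, 29, 30, 34, 38, 42} : Finset ℕ)).filter (· < e)).card) (fun e => by rw [hT]) ?_
  decide

end Summit.ValiantsHypothesis.ValiantsHypothesis.Theorems.LacunarySymmetroidMatrixDescartes.Census
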